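import Mathlib

/-!
# Defect certificate for `QuarticGate` (line `recession-cone`) — the abstract cone lemma

Finite-dimensional convex duality behind stub S3 (`stub_defectCertificate`): in a
finite-dimensional real vector space `W`, a family of linear functionals `ev x` (`x : X`) whose
"nonnegativity cone is trivial" — every `P` with `ev x P ≥ 0` for all `x` is killed by every `ev x`
and by a further functional `ψ` — conically generates `-ψ`: `ψ + Σₗ cₗ ev (xₗ) = 0` with finitely
many `xₗ` and `cₗ ≥ 0`. The proof is the cone/separation argument of
`Literature.MeasureTheory.Moments.TruncatedMomentPositivity` (`FialkowNie2010.mem_hull_momentVectors`)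
run in coordinates of a complement of the common kernel of the `ev x`.
-/

namespace Summit.AnomalousDissipation.AnomalousDissipation.Theorems.MomentParityQuarticGate

open Module

set_option linter.dupNamespace false

/-- **Coordinates: the conic hull of the evaluation vectors is everything.** Let `b : ι → W` be a
finite family and `ev x` (`x : X`) linear functionals on `W` such that a coefficient functional
`F` on `ι → ℝ` vanishes as soon as `P_F := Σᵢ F(δᵢ) bᵢ` has `ev x P_F ≥ 0` for all `x`. Then every
vector of `ι → ℝ` is a finite conic combination of the vectors `(ev x bᵢ)ᵢ`. [folklore] -/
theorem mem_hull_evalVectors {W : Type*} [AddCommGroup W] [Module ℝ W] {X ι : Type*} [Fintype ι]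
    [DecidableEq ι] (b : ι → W) (ev : X → W →ₗ[ℝ] ℝ)
    (h : ∀ F : (ι → ℝ) →ₗ[ℝ] ℝ,
      (∀ x, 0 ≤ ev x (∑ i, F (fun j => if i = j then 1 else 0) • b i)) → F = 0)
    (y : ι → ℝ) :
    y ∈ PointedCone.hull ℝ (Set.range fun (x : X) (i : ι) => ev x (b i)) := by
  set v : X → ι → ℝ := fun x i => ev x (b i) with hv
  set C : PointedCone ℝ (ι → ℝ) := PointedCone.hull ℝ (Set.range v) with hCdef
  have hconv : Convex ℝ (C : Set (ι → ℝ)) := C.convex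
  have hvC : ∀ x, v x ∈ C := fun x => PointedCone.subset_hull ⟨x, rfl⟩
  -- a linear functional `F` on `ι → ℝ` is `w ↦ Σ_i F(δ_i) w_i`
  have key : ∀ (F : (ι → ℝ) →ₗ[ℝ] ℝ) (w : ι → ℝ),
      F w = ∑ i, (F fun j => if i = j then 1 else 0) * w i := fun F w => by
    rw [LinearMap.pi_apply_eq_sum_univ F w]
    simp_rw [smul_eq_mul, mul_comm]
  -- the element `P F = Σ_i F(δ_i) b_i` attached to `F`
  set P : ((ι → ℝ) →ₗ[ℝ] ℝ) → W :=
    fun F => ∑ i, (F fun j => if i = j then 1 else 0) • b i with hPdef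
  have hPeval : ∀ (F : (ι → ℝ) →ₗ[ℝ] ℝ) (x : X), ev x (P F) = F (v x) := fun F x => by
    rw [key F (v x), hPdef]
    simp only [map_sum, map_smul, smul_eq_mul, hv]
  -- (a) the evaluation vectors span everything ...
  have hspan : Submodule.span ℝ (Set.range v) = ⊤ := by
    by_contra hne
    obtain ⟨F, hF0, hle⟩ := Submodule.exists_le_ker_of_lt_top _ (lt_top_iff_ne_top.mpr hne)
    refine hF0 (h F fun x => ?_)
    rw [hPeval]
    exact (LinearMap.mem_ker.mp (hle (Submodule.subset_span ⟨x, rfl⟩))).symm.le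
  -- ... ⟹ `int C ≠ ∅`
  have hint : (interior (C : Set (ι → ℝ))).Nonempty := by
    rw [hconv.interior_nonempty_iff_affineSpan_eq_top,
      AffineSubspace.affineSpan_eq_top_iff_vectorSpan_eq_top_of_nonempty ℝ _ _
        ⟨0, C.zero_mem⟩, vectorSpan_def, eq_top_iff, ← hspan]
    refine Submodule.span_mono ?_
    rintro _ ⟨x, rfl⟩
    exact ⟨v x, hvC x, 0, C.zero_mem, by simp⟩
  -- (b) separation: if `y ∉ C` a nonzero functional attains its max over `C` at `y`
  by_contra hy
  have hy' : y ∉ interior (C : Set (ι → ℝ)) := fun h' => hy (interior_subset h')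
  obtain ⟨f, hf0, hf⟩ := geometric_hahn_banach_of_nonempty_interior_point hconv hy' hint
  have hfy : 0 ≤ f y := by simpa using hf 0 C.zero_mem
  -- `C` is a cone, so `f ≤ 0` on `C`
  have hfC : ∀ a ∈ C, f a ≤ 0 := by
    intro a ha
    by_contra hfa
    push Not at hfa
    have hmem : ((f y + 1) / f a) • a ∈ C := C.smul_mem (div_nonneg (by linarith) hfa.le) ha
    have h' := hf _ hmem
    rw [map_smul, smul_eq_mul, div_mul_cancel₀ _ hfa.ne'] at h'
    linarith
  -- the functional `-f` is nonnegative on all evaluation vectors, hence zero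
  set F : (ι → ℝ) →ₗ[ℝ] ℝ := -(f : (ι → ℝ) →ₗ[ℝ] ℝ) with hF
  have hFapply : ∀ w, F w = -f w := fun w => by simp [hF]
  have hFzero : F = 0 := h F fun x => by
    rw [hPeval, hFapply, Left.nonneg_neg_iff]
    exact hfC _ (hvC x)
  apply hf0
  ext w
  have hw := hFapply w
  rw [hFzero, LinearMap.zero_apply] at hw
  have hw0 : f w = 0 := by linarith
  simp [hw0]

/-- **The abstract cone lemma (finite-dimensional convex duality).** In a finite-dimensional real
vector space `W`, let `ev x` (`x : X`) and `ψ` be linear functionals such that every `P` with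
`ev x P ≥ 0` for all `x` satisfies `ψ P = 0` and `ev x P = 0` for all `x`. Then `-ψ` is a finite
conic combination of evaluations: there are finitely many `xₗ` and weights `cₗ ≥ 0` with
`ψ P + Σₗ cₗ ev (xₗ) P = 0` for every `P`. (The convex cone generated by the `ev x` in the dual of
`W ⧸ ⋂ ker (ev x)` has trivial dual, hence is the whole space.) [folklore] -/
theorem exists_conic_certificate :
    ∀ {W : Type} [AddCommGroup W] [Module ℝ W] [FiniteDimensional ℝ W] {X : Type}
      (ev : X → W →ₗ[ℝ] ℝ) (ψ : W →ₗ[ℝ] ℝ),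
      (∀ P : W, (∀ x, 0 ≤ ev x P) → ψ P = 0 ∧ ∀ x, ev x P = 0) →
      ∃ (M : ℕ) (x : Fin M → X) (c : Fin M → ℝ), (∀ l, 0 ≤ c l) ∧
        ∀ P, ψ P + ∑ l, c l * ev (x l) P = 0 := by
  intro W _ _ _ X ev ψ h
  classical
  -- the common kernel `Z` of the evaluations and a complement `W₁` with a finite basis
  set Z : Submodule ℝ W := ⨅ x, LinearMap.ker (ev x) with hZ
  have hmemZ : ∀ P, P ∈ Z ↔ ∀ x, ev x P = 0 := fun P => by
    simp [hZ, Submodule.mem_iInf, LinearMap.mem_ker]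
  obtain ⟨W₁, hW₁⟩ := Z.exists_isCompl
  set bW := Module.finBasis ℝ W₁ with hbW
  set b : Fin (finrank ℝ W₁) → W := fun i => (bW i : W) with hb
  -- the hypothesis of the coordinate lemma
  have hcoord : ∀ F : (Fin (finrank ℝ W₁) → ℝ) →ₗ[ℝ] ℝ,
      (∀ x, 0 ≤ ev x (∑ i, F (fun j => if i = j then 1 else 0) • b i)) → F = 0 := by
    intro F hF
    set a : Fin (finrank ℝ W₁) → ℝ := fun i => F (fun j => if i = j then 1 else 0) with ha
    have hPW₁ : (∑ i, a i • b i) ∈ W₁ :=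
      Submodule.sum_mem _ fun i _ => Submodule.smul_mem _ _ (bW i).2
    have hPZ : (∑ i, a i • b i) ∈ Z := (hmemZ _).2 (h _ hF).2
    have hP0 : (∑ i, a i • b i) = 0 := Submodule.disjoint_def.mp hW₁.disjoint _ hPZ hPW₁
    have hP0' : (∑ i, a i • bW i) = 0 := by
      apply Subtype.val_injective
      rw [Submodule.coe_sum]
      simpa [hb] using hP0
    have ha0 : ∀ i, a i = 0 := Fintype.linearIndependent_iff.mp bW.linearIndependent a hP0'
    refine LinearMap.ext fun w => ?_
    rw [LinearMap.pi_apply_eq_sum_univ F w, LinearMap.zero_apply]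
    exact Finset.sum_eq_zero fun i _ => by
      rw [show F (fun j => if i = j then 1 else 0) = a i from rfl, ha0 i, smul_zero]
  -- the vector `(-ψ bᵢ)ᵢ` is a conic combination of evaluation vectors
  have hy := mem_hull_evalVectors b ev hcoord fun i => -ψ (b i)
  rw [PointedCone.mem_hull_set] at hy
  obtain ⟨c, hcsupp, hc0, hcsum⟩ := hy
  have hpt : ∀ w ∈ c.support, ∃ x : X, (fun i => ev x (b i)) = w := fun w hw => hcsupp hw
  choose pt hptv using hpt
  -- reindex the support by `Fin M`
  set M := c.support.card with hM
  set e := c.support.equivFin with he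
  refine ⟨M, fun l => pt (e.symm l).1 (e.symm l).2, fun l => c (e.symm l).1, fun l => hc0 _, ?_⟩
  -- the certificate functional
  set Λ : W →ₗ[ℝ] ℝ := ψ + ∑ l, c (e.symm l).1 • ev (pt (e.symm l).1 (e.symm l).2) with hΛ
  have hΛapply : ∀ P, Λ P = ψ P + ∑ l, c (e.symm l).1 * ev (pt (e.symm l).1 (e.symm l).2) P :=
      fun P => by
    simp [hΛ, LinearMap.sum_apply]
  -- it vanishes on the basis of `W₁` ...
  have hΛb : ∀ i, Λ (b i) = 0 := by
    intro i
    rw [hΛapply]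
    have hi := congr_fun hcsum i
    simp only [Finsupp.sum, Finset.sum_apply, Pi.smul_apply, smul_eq_mul] at hi
    have hsum : ∑ l, c (e.symm l).1 * ev (pt (e.symm l).1 (e.symm l).2) (b i) =
        ∑ w ∈ c.support, c w * w i := by
      rw [← Finset.sum_coe_sort c.support]
      refine (Fintype.sum_equiv e.symm _ (fun w => c w.1 * w.1 i) fun l => ?_)
      rw [← congr_fun (hptv _ (e.symm l).2) i]
    rw [hsum, hi]
    ring
  -- ... and on `Z`
  have hΛZ : ∀ z ∈ Z, Λ z = 0 := by
    intro z hz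
    have hz' := (hmemZ z).1 hz
    rw [hΛapply, (h z fun x => (hz' x).symm.le).1]
    simp [hz']
  -- hence everywhere
  have hΛW₁ : W₁ ≤ LinearMap.ker Λ := by
    intro p hp
    have hcomp : Λ.comp W₁.subtype = 0 := bW.ext fun i => by
      simpa [hb] using hΛb i
    simpa using LinearMap.congr_fun hcomp ⟨p, hp⟩
  have hΛZ' : Z ≤ LinearMap.ker Λ := fun z hz => LinearMap.mem_ker.2 (hΛZ z hz)
  have htop : (⊤ : Submodule ℝ W) ≤ LinearMap.ker Λ := by
    rw [← hW₁.sup_eq_top]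
    exact sup_le hΛZ' hΛW₁
  intro P
  rw [← hΛapply]
  exact LinearMap.mem_ker.1 (htop Submodule.mem_top)

end Summit.AnomalousDissipation.AnomalousDissipation.Theorems.MomentParityQuarticGate
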